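import Summits.MatrixMultiplication.MatrixMultiplication.Theorems.OutsiderSandwichRefinedCapacity
import HarnessLib

/-!
# Coherent certificates have rate at least `log₂(4/3) / (1 + log₂(4/3)) = 0.2933…`

Route `OutsiderSandwich` (decomposition cell `decomp-mm`, lens 4 «minimal counterexample /
extremal reduction», gen 28, kernel 2), support for the aside leaf `BlockOneIsMM`
(stmt-MatrixMultiplication-27147, `θ⋆ = 0`); cut of record untouched; theorem-only.

## Content

`OutsiderSandwichCoherentSharing.four_pow_le_sq_card_mul_three_pow` priced COHERENT certificates
(wiring normal form `Σ_{(i,c) ∈ T} R_{i,c}(τ_c(A_i X) · L_{i,c} Y) = X · Y`, every two wired blocks of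
a copy relatively sign-untwisted) by `4^N ≤ |ι|² · 3^N` — rate `½ log₂(4/3) = 0.2075…` — from the
subset constraint `4^N ≤ Σ_i min(rank A_i, 2^N k_i)` and the linear capacity law
`k_i · rank A_i ≤ 6^N`.  With the refined (geometric) capacity law of
`OutsiderSandwichRefinedCapacity` (`k_i ≤ 2^{j_i}`, `rank A_i ≤ 3^{j_i} 4^{N-j_i}`) the same
subset constraint gives:

* `exists_profile_of_coherent` — a coherent certificate has a LEVEL `j ≤ N` with
  `4^N ≤ |ι| · 3^j 4^{N-j}` AND `2^{N-j} ≤ |ι|`: `|ι| ≥ max((4/3)^j, 2^{N-j})`.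
* `coherent_rate_refined` — hence `N · log 2 · log(4/3) ≤ log(8/3) · log |ι|`: coherent families
  have exchange rate `≥ log(4/3)/log(8/3) = L/(1+L) = 0.29331…` (`L = log₂(4/3) = 0.41504`, the
  rate of the symmetric core), up from `L/2`.
* `profile_numerics` — coherent certificates need `|ι| ≥ 2, 3, 4, 6, 32` at `N = 3, 4, 5, 8, 16`
  (old bound: `2, 2, 3, 4, 10`; attained column-disjoint values `⌈(4/3)^N⌉ = 3, 4, 5, 10, 100`).

Reading (memo NODE-g28): the two inequalities are exactly the `x`-flattening and the `z`-flattening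
of the best coordinate-structured coherent family (`x`-leg read in the `2^j`-pattern coset of a
`j`-coordinate subgroup, range `Sym₂^{⊗j} ⊗ M₂^{⊗(N-j)}`), whose known constructions have rate
`(1 - j/N) + L · j/N ≥ L`; whether coherent certificates can go below the core rate `L` at all —
anywhere in `[L/(1+L), L]` — is an asymptotic-spectrum question for the explicit pair
`(⟨2,2,2⟩ ; ⟨2,2,1⟩^{⊠(1-γ)} ⊠ t₀^{⊠γ})`, `t₀ = (S; u, w) ↦ (Su, Sw)` on symmetric `2 × 2` matrices,
not reachable by flattening counts (the quantum functionals interpolate the two flattenings and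
`t₀` is flattening-exact).  For the leaf: every rate `< L/(1+L)`, in particular `θ⋆ = 0`, needs
INCOHERENT copies (`OutsiderSandwichCoherentSharing.exists_incoherent_copy_of_lt`, now below
`0.2933…` instead of `0.2075…`).

## References

* M. Bläser, *Fast Matrix Multiplication*, Theory of Computing Graduate Surveys 5 (2013), §5–6.
  [Blaser2013]
* M. Christandl, P. Vrana, J. Zuiddam, *Universal points in the asymptotic spectrum of tensors*,
  J. AMS 36 (2023), §1 (quantum functionals, flattenings as spectral points).
  [ChristandlVranaZuiddam2023]
-/

noncomputable section

open scoped BigOperators Matrix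

set_option linter.dupNamespace false
set_option autoImplicit false

namespace Summit.MatrixMultiplication.MatrixMultiplication.Theorems.OutsiderSandwichCoherentProfile

open Summit.MatrixMultiplication.MatrixMultiplication.Theorems.OutsiderSandwichTwistGluing
  Summit.MatrixMultiplication.MatrixMultiplication.Theorems.OutsiderSandwichTwistCapacity
  Summit.MatrixMultiplication.MatrixMultiplication.Theorems.OutsiderSandwichCoherentSharing
  Summit.MatrixMultiplication.MatrixMultiplication.Theorems.OutsiderSandwichRefinedCapacity

universe u v

variable {N : ℕ} {K : Type u} [Field K] {ι : Type v} [Fintype ι]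

/-- **The level of a coherent certificate.**  In the wiring normal form, if every two wired blocks
of the same copy are relatively sign-untwisted, then for some `j ≤ N`:
`4^N ≤ |ι| · 3^j · 4^{N-j}` (the `x`-legs must deliver `4^N` dimensions at geometric capacity) and
`2^{N-j} ≤ |ι|` (the wired blocks must deliver `4^N` outputs, `≤ 2^j` blocks per copy). -/
theorem exists_profile_of_coherent [DecidableEq ι]
    (A : ι → Matrix (Idx N) (Idx N) K →ₗ[K] Matrix (Idx N) (Idx N) K) (T : Finset (ι × Idx N))
    (L : ι → Idx N → (Matrix (Idx N) (Idx N) K →ₗ[K] (Idx N → K)))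
    (R : ι → Idx N → ((Idx N → K) →ₗ[K] Matrix (Idx N) (Idx N) K))
    (ident : ∀ X Y : Matrix (Idx N) (Idx N) K,
      ∑ b ∈ T, R b.1 b.2 (Matrix.mulVec (ptrans b.2 (A b.1 X)) (L b.1 b.2 Y)) = X * Y)
    (hRel : ∀ i c c', (i, c) ∈ T → (i, c') ∈ T →
      ∃ ε : K, ∀ X, ptrans (c + c') (A i X) = ε • A i X) :
    ∃ j ≤ N, 4 ^ N ≤ Fintype.card ι * (3 ^ j * 4 ^ (N - j)) ∧ 2 ^ (N - j) ≤ Fintype.card ι := by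
  classical
  let e : ι → ℕ := fun i => Module.finrank K (LinearMap.range (A i))
  let k : ι → ℕ := fun i => (T.filter fun b : ι × Idx N => b.1 = i).card
  -- (1) refined capacity per copy
  have hprof : ∀ i, ∃ j, j ≤ N ∧ k i ≤ 2 ^ j ∧ e i ≤ 3 ^ j * 4 ^ (N - j) := by
    intro i
    have hC : ((T.filter fun b : ι × Idx N => b.1 = i).image Prod.snd).card = k i :=
      Finset.card_image_of_injOn fun b₁ h₁ b₂ h₂ h => by
        simp only [Finset.coe_filter, Set.mem_setOf_eq] at h₁ h₂
        exact Prod.ext (h₁.2.trans h₂.2.symm) h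
    have hmem : ∀ c ∈ (T.filter fun b : ι × Idx N => b.1 = i).image Prod.snd, (i, c) ∈ T := by
      intro c hc
      obtain ⟨⟨i', c'⟩, hb, rfl⟩ := Finset.mem_image.1 hc
      obtain ⟨hT, rfl⟩ := Finset.mem_filter.1 hb
      exact hT
    obtain ⟨j, hjN, hjk, hje⟩ := exists_rank_profile_range_of_relative (A i) _
      fun c hc c' hc' => hRel i c c' (hmem c hc) (hmem c' hc')
    exact ⟨j, hjN, hC ▸ hjk, hje⟩
  choose j hjN hjk hje using hprof
  -- (2) the subset constraint at `S = {i : e i ≤ 2^N k i}`: `4^N ≤ Σ_i min (e i) (2^N k i)`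
  let p : ι → Prop := fun i => e i ≤ 2 ^ N * k i
  have h1 := four_pow_le_sum_finrank_add A T L R ident (Finset.univ.filter p)
  have h2 : (T.filter fun b : ι × Idx N => b.1 ∉ Finset.univ.filter p).card ≤
      ∑ i ∈ Finset.univ.filter (fun i => ¬ p i), k i := by
    have hsub : (T.filter fun b : ι × Idx N => b.1 ∉ Finset.univ.filter p) ⊆
        (Finset.univ.filter fun i => ¬ p i).biUnion
          (fun i => T.filter fun b : ι × Idx N => b.1 = i) := by
      intro b hb
      simp only [Finset.mem_filter, Finset.mem_univ, true_and] at hb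
      simp only [Finset.mem_biUnion, Finset.mem_filter, Finset.mem_univ, true_and]
      exact ⟨b.1, hb.2, hb.1, rfl⟩
    exact (Finset.card_le_card hsub).trans Finset.card_biUnion_le
  have hmin : ∑ i ∈ Finset.univ.filter p, e i +
      2 ^ N * ∑ i ∈ Finset.univ.filter (fun i => ¬ p i), k i = ∑ i, min (e i) (2 ^ N * k i) := by
    rw [Finset.mul_sum, ← Finset.sum_filter_add_sum_filter_not Finset.univ p]
    congr 1
    · exact Finset.sum_congr rfl fun i hi => (min_eq_left (Finset.mem_filter.1 hi).2).symm
    · exact Finset.sum_congr rfl fun i hi =>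
        (min_eq_right (le_of_lt (not_le.1 (Finset.mem_filter.1 hi).2))).symm
  have h3 : 4 ^ N ≤ ∑ i, min (e i) (2 ^ N * k i) := by
    rw [← hmin]
    exact h1.trans (Nat.add_le_add_left (Nat.mul_le_mul_left _ h2) _)
  -- (3) each `min` is at most the copy's level value, and some copy has the largest level value
  let m : ι → ℕ := fun i => min (3 ^ j i * 4 ^ (N - j i)) (2 ^ N * 2 ^ j i)
  have h4 : ∀ i, min (e i) (2 ^ N * k i) ≤ m i :=
    fun i => min_le_min (hje i) (Nat.mul_le_mul_left _ (hjk i))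
  have hne : (Finset.univ : Finset ι).Nonempty := by
    rw [Finset.univ_nonempty_iff]
    by_contra hι
    rw [not_nonempty_iff] at hι
    rw [Finset.univ_eq_empty, Finset.sum_empty] at h3
    exact absurd h3 (not_le.2 (pow_pos (by norm_num) N))
  obtain ⟨i₀, -, hmax⟩ := Finset.exists_max_image Finset.univ m hne
  have h5 : 4 ^ N ≤ Fintype.card ι * m i₀ := by
    calc 4 ^ N ≤ ∑ i, min (e i) (2 ^ N * k i) := h3
      _ ≤ ∑ i, m i := Finset.sum_le_sum fun i _ => h4 i
      _ ≤ ∑ _i : ι, m i₀ := Finset.sum_le_sum fun i _ => hmax i (Finset.mem_univ i)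
      _ = Fintype.card ι * m i₀ := by rw [Finset.sum_const, Finset.card_univ, smul_eq_mul]
  refine ⟨j i₀, hjN i₀, h5.trans (Nat.mul_le_mul_left _ (min_le_left _ _)), ?_⟩
  have h6 : 4 ^ N ≤ Fintype.card ι * (2 ^ N * 2 ^ j i₀) :=
    h5.trans (Nat.mul_le_mul_left _ (min_le_right _ _))
  have key : 2 ^ (N - j i₀) * (2 ^ N * 2 ^ j i₀) = 4 ^ N := by
    rw [mul_left_comm, ← pow_add, Nat.sub_add_cancel (hjN i₀), ← mul_pow]
    norm_num
  rw [← key] at h6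
  exact Nat.le_of_mul_le_mul_right h6 (by positivity)

/-- **Rate form.**  `4^N ≤ B · 3^j 4^{N-j}` and `2^{N-j} ≤ B` (`j ≤ N`, `B ≥ 1`) give
`j · log(4/3) ≤ log B` and `(N - j) · log 2 ≤ log B`, hence — eliminating `j` —
`N · log 2 · log(4/3) ≤ (log 2 + log(4/3)) · log B = log(8/3) · log B`: coherent families have
exchange rate at least `log(4/3) / log(8/3) = 0.29331…`. -/
theorem coherent_rate_refined {N B j : ℕ} (hB : 1 ≤ B) (hjN : j ≤ N)
    (h1 : 4 ^ N ≤ B * (3 ^ j * 4 ^ (N - j))) (h2 : 2 ^ (N - j) ≤ B) :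
    (N : ℝ) * (Real.log 2 * Real.log (4 / 3)) ≤ Real.log (8 / 3) * Real.log B := by
  obtain ⟨m, rfl⟩ := Nat.exists_eq_add_of_le hjN
  rw [Nat.add_sub_cancel_left] at h1 h2
  have hB' : (0 : ℝ) < B := by exact_mod_cast hB
  -- `(4/3)^j ≤ B`
  have hA : (j : ℝ) * Real.log (4 / 3) ≤ Real.log B := by
    have h1' : (4 : ℝ) ^ j * 4 ^ m ≤ B * 3 ^ j * 4 ^ m := by
      have : ((4 ^ (j + m) : ℕ) : ℝ) ≤ ((B * (3 ^ j * 4 ^ m) : ℕ) : ℝ) := by exact_mod_cast h1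
      push_cast at this
      rw [pow_add] at this
      linarith
    have h1'' : (4 : ℝ) ^ j ≤ B * 3 ^ j := le_of_mul_le_mul_right h1' (by positivity)
    have hlog := Real.log_le_log (by positivity) h1''
    rw [Real.log_pow, Real.log_mul (by positivity) (by positivity), Real.log_pow] at hlog
    rw [Real.log_div (by norm_num) (by norm_num), mul_sub]
    linarith
  -- `2^m ≤ B`
  have hC : (m : ℝ) * Real.log 2 ≤ Real.log B := by
    have h2' : (2 : ℝ) ^ m ≤ B := by exact_mod_cast h2
    have hlog := Real.log_le_log (by positivity) h2'
    rwa [Real.log_pow] at hlog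
  have hl2 : 0 < Real.log 2 := Real.log_pos (by norm_num)
  have hl43 : 0 < Real.log (4 / 3) := Real.log_pos (by norm_num)
  have e1 := mul_le_mul_of_nonneg_left hA hl2.le
  have e2 := mul_le_mul_of_nonneg_left hC hl43.le
  rw [show Real.log (8 / 3) = Real.log 2 + Real.log (4 / 3) by
    rw [← Real.log_mul (by norm_num) (by norm_num)]; norm_num]
  push_cast
  nlinarith [e1, e2]

/-- **Numerics** (minimise `max((4/3)^j, 2^{N-j})` over `j ≤ N`): a coherent certificate needs
`|ι| ≥ 2, 3, 4, 6, 32` copies at `N = 3, 4, 5, 8, 16` — against `2, 2, 3, 4, 10` from the square-root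
bound and the attained core values `3, 4, 5, 10, 100`. -/
theorem profile_numerics :
    (∀ j B : ℕ, j ≤ 3 → 4 ^ 3 ≤ B * (3 ^ j * 4 ^ (3 - j)) → 2 ^ (3 - j) ≤ B → 2 ≤ B) ∧
    (∀ j B : ℕ, j ≤ 4 → 4 ^ 4 ≤ B * (3 ^ j * 4 ^ (4 - j)) → 2 ^ (4 - j) ≤ B → 3 ≤ B) ∧
    (∀ j B : ℕ, j ≤ 5 → 4 ^ 5 ≤ B * (3 ^ j * 4 ^ (5 - j)) → 2 ^ (5 - j) ≤ B → 4 ≤ B) ∧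
    (∀ j B : ℕ, j ≤ 8 → 4 ^ 8 ≤ B * (3 ^ j * 4 ^ (8 - j)) → 2 ^ (8 - j) ≤ B → 6 ≤ B) ∧
    (∀ j B : ℕ, j ≤ 16 → 4 ^ 16 ≤ B * (3 ^ j * 4 ^ (16 - j)) → 2 ^ (16 - j) ≤ B → 32 ≤ B) := by
  refine ⟨?_, ?_, ?_, ?_, ?_⟩ <;> intro j B hj h1 h2 <;> interval_cases j <;> omega

end Summit.MatrixMultiplication.MatrixMultiplication.Theorems.OutsiderSandwichCoherentProfile
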